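import Mathlib
import Summits.Ventures.PercRepro2.K5TypedK3
import Summits.Ventures.PercRepro2.K5K3Transfer
import Summits.Ventures.PercRepro2.K5K3Multi
import Summits.Ventures.PercRepro2.K5K3Cert4
import Summits.Ventures.PercRepro2.K5K3Cert3
import Summits.Ventures.PercRepro2.K5K3Cert0

/-!
# THE TYPED `K₃` BASE ON `K₅`, AT THE THREE MARKINGS
(blind cell PercRepro2, typer-1 g10; lead g26 03:29:09Z «K5TypedK3»)

`K5TypedK3.lean` derives the typed base of p1's kernel `K₃` on `K₅` at the marks `(0, 1, 2, 3, b)` from the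
certificate `Cert3 b`; the three kernel certificates (`K5K3Cert4.lean`, `K5K3Cert3.lean`, `K5K3Cert0.lean`)
instantiate it:

* **`typedCount_K3_nonneg`** / **`typedBases_K5`**: distinct marks `(o, a₁, a₂, a₃, b) = (0, 1, 2, 3, 4)` —
  row 2′TRI on `K₅` (all minors, all type maps; `CovForm.TypedBases ends5 0 1 2 3 4`);
* **`typedBases_K5_b3`**: the coincidence `b = a₃` (marks `(0, 1, 2, 3, 3)`);
* **`typedBases_K5_ob`**: the coincidence `o = b` (marks `(0, 1, 2, 3, 0)`) —

the three markings allowed by p2's `MarksDistinct` (roots distinct from every other mark, `o ≠ a₃`);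
* **`typedCount_K3_nonneg_allMarked`** (`K5K3Transfer.lean` instantiated): on EVERY finite graph, for marks
  with `a₁, a₂` distinct from every other mark and `o ≠ a₃`, every typed count
  `typedCount F (fun _ => false) τ (K3 ends o a₁ a₂ a₃ b)` with `F` loop-free, parallel-free and every end
  of every typed edge a mark is `≥ 0` — p2's subtraction of the all-marked instances of `ResidualCore`
  (03:22:27Z; the hypotheses are exactly `MarksDistinct` and `Reduced.no_loop` / `no_parallel`);
* **`typedCount_K3_nonneg_multi`** (`K5K3Multi.lean` instantiated): the same with PARALLEL typed edges
  allowed (the typed parallel rule `K5K3Merge.typedCount_merge`, mine-1's adjoined-object tables) — the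
  typed `K₃` base on every all-marked loop-free multigraph, every type map (p2's hat class is built on
  it); **`typedCount_K3_nonneg_multi_loops`**: loops allowed too (the typed loop rule
  `K5K3Multi.typedCount_loop`) — every all-marked multigraph.

Consequences on `K₅`: `HCov_K5` ((HCOV) for every weight vector, `CovForm.HCov_of_typedBases`).
-/

namespace Summit.Ventures.PercRepro2

namespace K5

section Marks

variable {R : Type*} [Field R] [LinearOrder R] [IsStrictOrderedRing R]

/-- **Every weight-free typed count of `K₃` on `K₅` at distinct marks is nonnegative.** -/
theorem typedCount_K3_nonneg (F : Finset (Fin 10)) (z : Config (Fin 10)) (τ : Fin 10 → ℕ) :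
    0 ≤ typedCount F z τ (CovForm.K3 (R := R) ends5 0 1 2 3 4) :=
  typedCount_K3_nonneg_of_cert 4 cert3_4 F z τ

/-- **Row 2′TRI on `K₅`** at the marks `(o, a₁, a₂, a₃, b) = (0, 1, 2, 3, 4)`. -/
theorem typedBases_K5 : CovForm.TypedBases (R := R) ends5 0 1 2 3 4 :=
  typedBases_K5_of_cert 4 cert3_4

/-- **Row 2′TRI on `K₅` at the coincidence `b = a₃`** (marks `(0, 1, 2, 3, 3)`). -/
theorem typedBases_K5_b3 : CovForm.TypedBases (R := R) ends5 0 1 2 3 3 :=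
  typedBases_K5_of_cert 3 cert3_3

/-- **Row 2′TRI on `K₅` at the coincidence `o = b`** (marks `(0, 1, 2, 3, 0)`). -/
theorem typedBases_K5_ob : CovForm.TypedBases (R := R) ends5 0 1 2 3 0 :=
  typedBases_K5_of_cert 0 cert3_0

/-- **(HCOV) on `K₅` for every admissible weight vector**, from the typed base. -/
theorem HCov_K5 (p : Fin 10 → R) (hp : IsProbVec p) : CovForm.HCov p ends5 0 1 2 3 4 :=
  CovForm.HCov_of_typedBases ends5 0 1 2 3 4 typedBases_K5 p hp

/-- **THE TYPED `K₃` BASE ON EVERY ALL-MARKED, LOOP-FREE, PARALLEL-FREE TYPED GRAPH** (p2's subtraction):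
for marks with `a₁, a₂` distinct from every other mark and `o ≠ a₃` (`b = a₃`, `o = b` allowed), every typed
count at `z ≡ false` on a set `F` of typed edges without loops or parallel edges whose ends are all marks is
nonnegative. -/
theorem typedCount_K3_nonneg_allMarked {V E : Type*} [Fintype E] [DecidableEq E] [DecidableEq V]
    (ends : E → Sym2 V) {o a₁ a₂ a₃ b : V} (h12 : a₁ ≠ a₂) (h31 : a₃ ≠ a₁) (h32 : a₃ ≠ a₂) (ho1 : o ≠ a₁)
    (ho2 : o ≠ a₂) (hb1 : b ≠ a₁) (hb2 : b ≠ a₂) (ho3 : o ≠ a₃) (F : Finset E) (τ : E → ℕ)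
    (hloop : ∀ e ∈ F, ¬ (ends e).IsDiag) (hpar : ∀ e ∈ F, ∀ e' ∈ F, ends e = ends e' → e = e')
    (hall : ∀ e ∈ F, ∀ v ∈ ends e, v = o ∨ v = a₁ ∨ v = a₂ ∨ v = a₃ ∨ v = b) :
    0 ≤ typedCount F (fun _ => false) τ (CovForm.K3 (R := R) ends o a₁ a₂ a₃ b) :=
  typedCount_K3_nonneg_of_marks cert3_4 cert3_3 cert3_0 ends h12 h31 h32 ho1 ho2 hb1 hb2 ho3 F τ hloop hpar
    hall

/-- **THE TYPED `K₃` BASE ON EVERY ALL-MARKED LOOP-FREE MULTIGRAPH** (parallel typed edges allowed, every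
type map): for marks with `a₁, a₂` distinct from every other mark and `o ≠ a₃`, every typed count at
`z ≡ false` on a loop-free set `F` of typed edges whose ends are all marks is nonnegative (the statement
p2's hat class is built on; `typedCount_K3_nonneg_multi_loops` drops the loop hypothesis). -/
theorem typedCount_K3_nonneg_multi {V E : Type*} [Fintype E] [DecidableEq E] [DecidableEq V]
    (ends : E → Sym2 V) {o a₁ a₂ a₃ b : V} (h12 : a₁ ≠ a₂) (h31 : a₃ ≠ a₁) (h32 : a₃ ≠ a₂) (ho1 : o ≠ a₁)
    (ho2 : o ≠ a₂) (hb1 : b ≠ a₁) (hb2 : b ≠ a₂) (ho3 : o ≠ a₃) (F : Finset E) (τ : E → ℕ)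
    (_hloop : ∀ e ∈ F, ¬ (ends e).IsDiag)
    (hall : ∀ e ∈ F, ∀ v ∈ ends e, v = o ∨ v = a₁ ∨ v = a₂ ∨ v = a₃ ∨ v = b) :
    0 ≤ typedCount F (fun _ => false) τ (CovForm.K3 (R := R) ends o a₁ a₂ a₃ b) :=
  typedCount_K3_nonneg_multi_of_certs cert3_4 cert3_3 cert3_0 ends h12 h31 h32 ho1 ho2 hb1 hb2 ho3 F τ hall

/-- **THE TYPED `K₃` BASE ON EVERY ALL-MARKED MULTIGRAPH** (loops and parallel typed edges allowed, every
type map): for marks with `a₁, a₂` distinct from every other mark and `o ≠ a₃`, every typed count at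
`z ≡ false` on a set `F` of typed edges whose ends are all marks is nonnegative. -/
theorem typedCount_K3_nonneg_multi_loops {V E : Type*} [Fintype E] [DecidableEq E] [DecidableEq V]
    (ends : E → Sym2 V) {o a₁ a₂ a₃ b : V} (h12 : a₁ ≠ a₂) (h31 : a₃ ≠ a₁) (h32 : a₃ ≠ a₂) (ho1 : o ≠ a₁)
    (ho2 : o ≠ a₂) (hb1 : b ≠ a₁) (hb2 : b ≠ a₂) (ho3 : o ≠ a₃) (F : Finset E) (τ : E → ℕ)
    (hall : ∀ e ∈ F, ∀ v ∈ ends e, v = o ∨ v = a₁ ∨ v = a₂ ∨ v = a₃ ∨ v = b) :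
    0 ≤ typedCount F (fun _ => false) τ (CovForm.K3 (R := R) ends o a₁ a₂ a₃ b) :=
  typedCount_K3_nonneg_multi_of_certs cert3_4 cert3_3 cert3_0 ends h12 h31 h32 ho1 ho2 hb1 hb2 ho3 F τ hall

end Marks

end K5

end Summit.Ventures.PercRepro2
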